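import Mathlib
import Summits.Ventures.PercRepro2.LocRows
import Summits.Ventures.PercRepro2.SwRow

/-!
# Row (SW) conditioned on a region around `l` — the statement (HLC) (blind cell PercRepro2, night-4 g9,
2026-08-25; proofs/NIGHT4-G9.md §4)

Free fibre (uniform 2-colouring, `ζ e = true` red), marks `l, h, o`, `Q = tgtU ends l h {S ∣ o ∈ S}`
= `{h ∉ H_l, o ∈ R_side(l)}`.  For a vertex set `U ∋ h` with `l ∉ U` and a configuration `ξ`, the
OUTSIDE CLASS `outClass U h ξ` is the set of configurations that agree with `ξ` on every edge NOT
touching `U` (the edges inside the region `W = Uᶜ ∋ l`) and whose hull of `h` (`C_R(h) ∪ C_B(h)`) lies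
inside `U`.  Statement (HLC): on every such class intersected with `Q` the blue cluster of `h`
dominates the red one — an injection of the class into itself carrying `C_R(h)` of the source into
`C_B(h)` of the image.

* `outClass`, `swOutSide` (= `Q ∩ outClass`), **`SwOut`** (the statement, all `U`, all `ξ`);
* `sw_of_swOut` — `U = {l}ᶜ` recovers row (SW): the classes are indexed by the colouring of the loops
  at `l` (the only edges not touching `{l}ᶜ`), they partition `Q`, and the class injections glue;
* `SwOut_all`, `sw_all_of_swOut_all : SwOut_all → Sw_all`.

Census (own code, exact Strassen / max-flow on every class): 0 failures on all connected graphs with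
n ≤ 6 (44,354 classes at n = 6) and on all connected graphs with n = 7 and m ≤ 15 (1,865,660 classes);
the exact-hull form (hull of `h` = `U`) fails from n = 7 (NEG-115's per-hull statement); pinning any
boundary edge of the region fails at n = 4.  A CONJECTURE of record for the planners, not a theorem.
-/

namespace Summit.Ventures.PercRepro2

namespace LocRows

open Hull

variable {V : Type*} {E : Type*} [Fintype E] [DecidableEq E]

open scoped Classical

variable (ends : E → Sym2 V)

/-- The outside class: configurations agreeing with `ξ` off the edges touching `U` whose hull of
`h` lies inside `U`. -/
noncomputable def outClass (U : Set V) (h : V) (ξ : Config E) : Finset (Config E) :=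
  Finset.univ.filter fun ζ => (∀ e, e ∉ touches ends U → ζ e = ξ e) ∧ hull ends ζ h ⊆ U

/-- `Q ∩ outClass`. -/
noncomputable def swOutSide (l h o : V) (U : Set V) (ξ : Config E) : Finset (Config E) :=
  tgtU ends l h {S : Set V | o ∈ S} ∩ outClass ends U h ξ

/-- **Statement (HLC)**: for every region `U ∋ h`, `l ∉ U`, and every outside colouring `ξ`, an
injection of `Q ∩ outClass U h ξ` into itself carrying the red cluster of `h` into the blue cluster
of `h` of the image (row (SW) conditioned on the colouring of the region `Uᶜ ∋ l`, among the
configurations whose hull of `h` avoids that region). -/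
def SwOut (l h o : V) : Prop :=
  ∀ (U : Set V) (ξ : Config E), h ∈ U → l ∉ U →
    ∃ f : {ζ // ζ ∈ swOutSide ends l h o U ξ} → Config E, Function.Injective f ∧
      ∀ x, f x ∈ swOutSide ends l h o U ξ ∧ cluster ends x.1 h ⊆ cluster ends (blue (f x)) h

variable {ends}

/-- Membership in the outside class. -/
lemma mem_outClass {U : Set V} {h : V} {ξ ζ : Config E} :
    ζ ∈ outClass ends U h ξ ↔ (∀ e, e ∉ touches ends U → ζ e = ξ e) ∧ hull ends ζ h ⊆ U := by
  simp only [outClass, Finset.mem_filter, Finset.mem_univ, true_and]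

/-- Membership in `swOutSide`. -/
lemma mem_swOutSide {l h o : V} {U : Set V} {ξ ζ : Config E} :
    ζ ∈ swOutSide ends l h o U ξ ↔
      ζ ∈ tgtU ends l h {S : Set V | o ∈ S} ∧ ζ ∈ outClass ends U h ξ := by
  simp only [swOutSide, Finset.mem_inter]

/-- On `Q` the hull of `h` avoids `l`. -/
lemma l_notMem_hull_of_mem_tgtU {l h o : V} {ζ : Config E}
    (hζ : ζ ∈ tgtU ends l h {S : Set V | o ∈ S}) : l ∉ hull ends ζ h := by
  simp only [tgtU, Finset.mem_filter, Finset.mem_univ, true_and] at hζ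
  intro hl
  apply hζ.1
  rcases hl with hl | hl
  · exact Or.inl (conn_symm hl)
  · exact Or.inr (conn_symm hl)

variable (ends) in
/-- The canonical representative of the outside colouring of `ζ` off the edges touching `U`. -/
noncomputable def outRep (U : Set V) (ζ : Config E) : Config E :=
  fun e => if e ∈ touches ends U then false else ζ e

omit [Fintype E] [DecidableEq E] in
/-- Agreeing off the edges touching `U` with `ζ` gives the same canonical representative. -/
lemma outRep_eq_of_agree {U : Set V} {ζ ζ' : Config E}
    (h : ∀ e, e ∉ touches ends U → ζ' e = ζ e) : outRep ends U ζ' = outRep ends U ζ := by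
  funext e
  simp only [outRep]
  split_ifs with he
  · rfl
  · exact h e he

/-- **(HLC) gives (SW)**: the region `U = {l}ᶜ`; the classes are indexed by the colouring of the
loops at `l`, partition `Q`, and their injections glue into one. -/
theorem sw_of_swOut (l h o : V) (hlh : l ≠ h) (hs : SwOut ends l h o) : Sw ends l h o := by
  -- the class injection for the canonical representative of each `ζ ∈ Q`
  have hU : h ∈ ({l}ᶜ : Set V) := by simpa using hlh.symm
  have hl : l ∉ ({l}ᶜ : Set V) := by simp
  choose f hf using fun ξ : Config E => hs ({l}ᶜ) ξ hU hl
  -- every `ζ ∈ Q` lies in the class of its own representative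
  have hmem : ∀ ζ ∈ tgtU ends l h {S : Set V | o ∈ S},
      ζ ∈ swOutSide ends l h o ({l}ᶜ) (outRep ends ({l}ᶜ) ζ) := by
    intro ζ hζ
    rw [mem_swOutSide, mem_outClass]
    refine ⟨hζ, ?_, ?_⟩
    · intro e he
      simp only [outRep, he, if_false]
    · intro x hx hxl
      simp only [Set.mem_singleton_iff] at hxl
      subst hxl
      exact l_notMem_hull_of_mem_tgtU hζ hx
  refine ⟨fun x => f (outRep ends ({l}ᶜ) x.1) ⟨x.1, hmem x.1 x.2⟩, ?_, ?_⟩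
  · intro x y hxy
    have hx := ((hf (outRep ends ({l}ᶜ) x.1)).2 ⟨x.1, hmem x.1 x.2⟩).1
    have hy := ((hf (outRep ends ({l}ᶜ) y.1)).2 ⟨y.1, hmem y.1 y.2⟩).1
    rw [mem_swOutSide, mem_outClass] at hx hy
    -- the images agree with the representatives of `x` and of `y` off `touches {l}ᶜ`
    have h1 := outRep_eq_of_agree (ends := ends) (U := {l}ᶜ) (ζ := outRep ends ({l}ᶜ) x.1)
      (ζ' := f (outRep ends ({l}ᶜ) x.1) ⟨x.1, hmem x.1 x.2⟩) hx.2.1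
    have h2 := outRep_eq_of_agree (ends := ends) (U := {l}ᶜ) (ζ := outRep ends ({l}ᶜ) y.1)
      (ζ' := f (outRep ends ({l}ᶜ) y.1) ⟨y.1, hmem y.1 y.2⟩) hy.2.1
    have hidem : ∀ ζ : Config E, outRep ends ({l}ᶜ) (outRep ends ({l}ᶜ) ζ) = outRep ends ({l}ᶜ) ζ := by
      intro ζ; funext e; simp only [outRep]; split_ifs <;> rfl
    have hrep : outRep ends ({l}ᶜ) x.1 = outRep ends ({l}ᶜ) y.1 := by
      rw [← hidem x.1, ← hidem y.1, ← h1, ← h2]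
      simp only at hxy
      rw [hxy]
    have hinj := (hf (outRep ends ({l}ᶜ) x.1)).1
    -- transport the `y`-term into the class of `x` along `hrep`
    have hcast : ∀ (ξ₁ ξ₂ : Config E) (hξ : ξ₁ = ξ₂) (a : {ζ // ζ ∈ swOutSide ends l h o ({l}ᶜ) ξ₁})
        (b : {ζ // ζ ∈ swOutSide ends l h o ({l}ᶜ) ξ₂}), a.1 = b.1 → f ξ₁ a = f ξ₂ b := by
      intro ξ₁ ξ₂ hξ a b hab
      subst hξ
      rw [Subtype.ext hab]
    have hy' : y.1 ∈ swOutSide ends l h o ({l}ᶜ) (outRep ends ({l}ᶜ) x.1) := by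
      rw [hrep]; exact hmem y.1 y.2
    have hxy' : f (outRep ends ({l}ᶜ) x.1) ⟨x.1, hmem x.1 x.2⟩ =
        f (outRep ends ({l}ᶜ) x.1) ⟨y.1, hy'⟩ := by
      simp only at hxy
      rw [hxy]
      exact hcast _ _ hrep.symm _ _ rfl
    have key := hinj hxy'
    have hval : x.1 = y.1 := Subtype.mk.inj key
    exact Subtype.ext hval
  · intro x
    have hx := (hf (outRep ends ({l}ᶜ) x.1)).2 ⟨x.1, hmem x.1 x.2⟩
    refine ⟨?_, hx.2⟩
    exact (mem_swOutSide.1 hx.1).1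

variable (ends)

/-- Statement (HLC) over all finite graphs and markings. -/
def SwOut_all : Prop :=
  ∀ (V E : Type) [Fintype V] [DecidableEq V] [Fintype E] [DecidableEq E] (ends : E → Sym2 V)
    (l h o : V), l ≠ h → o ≠ l → o ≠ h → SwOut ends l h o

/-- `SwOut_all` gives `Sw_all`. -/
theorem sw_all_of_swOut_all (hs : SwOut_all) : Sw_all := by
  intro V E _ _ _ _ ends l h o hlh hol hoh
  exact sw_of_swOut l h o hlh (hs V E ends l h o hlh hol hoh)

end LocRows

end Summit.Ventures.PercRepro2
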